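import Summits.Ventures.CertifiedManyBodySolver.Observables.PairLROTowerChargedTwist
import Literature.MathematicalPhysics.QuantumLattice.HubbardNNNHoppingTwistedFlipWindowCertificate
import Literature.MathematicalPhysics.QuantumLattice.CoordinateSlabs
import HarnessLib

/-!
# OP1-C, part 11: the CHARGED equation-of-motion term under the FLIP-TWISTED identification (`D₄ × flip`, the
# class of eng-2's B0 / E3 / UNION one-point objects) — spin-exchanged gauge-conjugated words and the
# flip-twisted space-group average

HONEST FRAMING: first certified bounds on pairing observables; not a superconductivity verdict; a ceiling route,
never presence; nothing in this file is a number. Crew hubbard-obs (D-0042), seat hubbard-obs-p1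
(`prover-hubbard-obs-p1-g9-0`); lead RULINGS (eo) d181 / (ex) d190; PAIRCORR-SDP §15.8 EXPORT RULE. Zero compute;
no definition; no named fact; no `sorry`.

The B0-class object of registry row 24 (kit j248069 spec, `obsb.py` «gauge_twist: true, spin_flip: true») — the
base of sr-mbsolver-menu-3's OP1-C Stage B cell certificates — is identified under
`T(((v,γ),f),m) = U_v D_γ F^f 𝒢_{j(γ)+f+2m}` (`twistedFlipSpaceGroupUnitary`, PairLROOnePointTwistedFlip). For an
OP1-C node typed in flip-twisted orbit-state form the charged eom term is `Re ω̄^{twf}_ζ(K_L Γ_L X − Γ_L X K_L)`,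
`K_L = H_L − μ'N̂`. This file reads it, on top of PairLROTowerChargedTwist:

* `spinSwapIter_mem_carEvenSubalgebra`, `conjTranspose_spinSwapIter`, `norm_totalNumberOp_commutator_spinSwapIter_le`
  — the spin-exchanged word `F^f A` (`spinSwapIter f A = relabel spinSwap^[f] A`) is even (with even adjoint) when
  `A` is, and `‖N̂₀(F^f A) − (F^f A)N̂₀‖ ≤ ‖N̂₀A − AN̂₀‖`;
* **`orbitState_twistedFlipSpaceGroupUnitary_commutator_fermionEmbed_of_invariant`** — for `K` invariant under
  `D₄`, translations, and commuting with `N̂` and the spin flip `F`: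
  `ω̄^{twf}_ζ([K, Γ_L X]) = (4|S|)⁻¹ Σ_{γ∈S} Σ_f Σ_m L⁻² ⟨ζ, [K, W_{γ,f,m}] ζ⟩`,
  `W_{γ,f,m} = Σ_v T_v Γ_{L,γΛ'}(Γ(d4Emb γ 0 Λ') F^f(𝒢_k X 𝒢_kᴴ))`, `k = j(γ)+f+2m`;
* `sum_translate_twistedFlipSpaceGroupAverage_eq` — `Σ_{γ,f,m} W_{γ,f,m}` is ONE translation sum of the symmetrised
  word on `Ω ⊇ ⋃_γ γΛ'`.

The family theorem and the leaf consumer follow in PairLROTowerChargedReadingTwistedFlip.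
References: O. Bratteli, D. W. Robinson, *Operator Algebras and Quantum Statistical Mechanics 2* (1997) §5.2.2,
§6.2.4 [BratteliRobinsonII1997]; X. Han, arXiv:2006.06002, §3 [Han2020Bootstrap]; T. Koma, H. Tasaki, J. Stat.
Phys. 76 (1994) 745 [KomaTasaki1994].
-/

noncomputable section

namespace Summit.Ventures.CertifiedManyBodySolver.Observables

open Matrix Complex Finset Literature.MathematicalPhysics.QuantumLattice Literature.Probability.LatticeModels
open Literature.MathematicalPhysics.QuantumLattice.HubbardWave0 ThermodynamicLimit Filter Topology
open Literature.MathematicalPhysics.QuantumManyBody.StateRelaxation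
open Summit.Ventures.CertifiedManyBodySolver.Transport
open scoped ComplexOrder ComplexConjugate BigOperators Matrix.Norms.L2Operator

/-! ### §1  The spin-exchanged word `F^f A`: evenness, adjoint, charge -/

section SpinSwapWord

variable {ι : Type*} [LinearOrder ι] [Fintype ι]

/-- A matrix with `Uᴴ U = 1` has operator norm `≤ 1`. [folklore] -/
private theorem norm_le_one_of_conjTranspose_mul_self₁ {U : Matrix (Finset ι) (Finset ι) ℂ} (hU : Uᴴ * U = 1) :
    ‖U‖ ≤ 1 := by
  have h := Matrix.l2_opNorm_conjTranspose_mul_self U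
  rw [hU] at h
  have h1 : ‖(1 : Matrix (Finset ι) (Finset ι) ℂ)‖ ≤ 1 := by
    have h0 := norm_ladderWord_le_one ([] : List (ι × Bool))
    rwa [ladderWord_nil] at h0
  nlinarith [norm_nonneg U]

/-- **Relabelling by a permutation of the orbitals is contractive** (it is conjugation by the signed permutation
unitary `U_π`): `‖relabel π A‖ ≤ ‖A‖`. [cite: BratteliRobinsonII1997, §5.2.2] -/
theorem norm_relabel_perm_le (π : Equiv.Perm ι) (A : Matrix (Finset ι) (Finset ι) ℂ) : ‖relabel π A‖ ≤ ‖A‖ := by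
  rw [relabel_eq_fockRelabel_conj, fockRelabel_val]
  have hU : ‖(relabelMatrix π : Matrix (Finset ι) (Finset ι) ℂ)‖ ≤ 1 :=
    norm_le_one_of_conjTranspose_mul_self₁ (fockRelabel_conjTranspose_mul_self π)
  have hUH : ‖(relabelMatrix π : Matrix (Finset ι) (Finset ι) ℂ)ᴴ‖ ≤ 1 := by
    refine norm_le_one_of_conjTranspose_mul_self₁ ?_
    rw [conjTranspose_conjTranspose]
    exact fockRelabel_mul_conjTranspose π
  calc ‖relabelMatrix π * A * (relabelMatrix π)ᴴ‖
      ≤ ‖relabelMatrix π * A‖ * ‖(relabelMatrix π : Matrix (Finset ι) (Finset ι) ℂ)ᴴ‖ := norm_mul_le _ _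
    _ ≤ (‖(relabelMatrix π : Matrix (Finset ι) (Finset ι) ℂ)‖ * ‖A‖) * 1 :=
        mul_le_mul (norm_mul_le _ _) hUH (norm_nonneg _) (by positivity)
    _ ≤ (1 * ‖A‖) * 1 := by gcongr
    _ = ‖A‖ := by ring

variable {Λ : Finset (Site 2)}

/-- **The spin-exchanged word is even** when the word is. [cite: BratteliRobinsonII1997, §5.2.2] -/
theorem spinSwapIter_mem_carEvenSubalgebra (k : ℕ) {A : FermionOp Λ}
    (hA : A ∈ carEvenSubalgebra (Finset.univ : Finset (Orb (PolySite Λ)))) :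
    spinSwapIter k A ∈ carEvenSubalgebra (Finset.univ : Finset (Orb (PolySite Λ))) := by
  induction k with
  | zero => simpa using hA
  | succ k ih =>
    rw [spinSwapIter_succ]
    have h := relabel_mem_carEvenSubalgebra (Orb.spinSwap : Orb (PolySite Λ) ≃ Orb (PolySite Λ)) ih
    rwa [Finset.map_univ_equiv] at h

/-- `(F^k A)ᴴ = F^k Aᴴ`. [folklore] -/
theorem conjTranspose_spinSwapIter (k : ℕ) (A : FermionOp Λ) : (spinSwapIter k A)ᴴ = spinSwapIter k Aᴴ := by
  induction k with
  | zero => simp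
  | succ k ih => rw [spinSwapIter_succ, spinSwapIter_succ, ← relabel_conjTranspose, ih]

/-- `N̂₀(F^k A) − (F^k A)N̂₀ = F^k (N̂₀A − AN̂₀)` (the spin exchange fixes `N̂₀`). [cite: BratteliRobinsonII1997, §5.2.2] -/
theorem totalNumberOp_commutator_spinSwapIter (k : ℕ) (A : FermionOp Λ) :
    (totalNumberOp : FermionOp Λ) * spinSwapIter k A - spinSwapIter k A * totalNumberOp =
      spinSwapIter k (totalNumberOp * A - A * totalNumberOp) := by
  induction k with
  | zero => simp
  | succ k ih =>
    have hN : relabel (Orb.spinSwap : Orb (PolySite Λ) ≃ Orb (PolySite Λ)) (totalNumberOp : FermionOp Λ) = totalNumberOp := by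
      rw [totalNumberOp_eq_totalNumber, relabel_spinSwap_totalNumber]
    rw [spinSwapIter_succ, spinSwapIter_succ, ← ih, relabel_sub, relabel_mul, relabel_mul, hN]

/-- **The spin-exchanged word has the same operator-norm charge**: `‖N̂₀(F^k A) − (F^k A)N̂₀‖ ≤ ‖N̂₀A − AN̂₀‖`.
[cite: BratteliRobinsonII1997, §5.2.2] -/
theorem norm_totalNumberOp_commutator_spinSwapIter_le (k : ℕ) (A : FermionOp Λ) :
    ‖(totalNumberOp : FermionOp Λ) * spinSwapIter k A - spinSwapIter k A * totalNumberOp‖ ≤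
      ‖(totalNumberOp : FermionOp Λ) * A - A * totalNumberOp‖ := by
  rw [totalNumberOp_commutator_spinSwapIter]
  set C : FermionOp Λ := totalNumberOp * A - A * totalNumberOp
  induction k with
  | zero => simp
  | succ k ih =>
    rw [spinSwapIter_succ]
    exact (norm_relabel_perm_le _ _).trans ih

end SpinSwapWord

/-! ### §2  The flip-twisted space-group average of a CHARGED equation-of-motion term -/

section TwistedFlipReading

variable {L : ℕ} [NeZero L]

/-- (Local to this section: the same `DecidableEq (FermionTorus 2 L)` shim under which
`TwistedFlipSpaceGroupUnitary` states its matrix powers `F^f`.) [folklore] -/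
local instance (priority := high) instDecidableEqFermionTorusTwFlipChg : DecidableEq (FermionTorus 2 L) :=
  LinearOrder.toDecidableEq

/-- `expect` is additive over finite sums. [folklore] -/
private theorem expect_finset_sum₄ {ι κ : Type*} [LinearOrder ι] [Fintype ι] (s : Finset κ)
    (f : κ → Matrix (Finset ι) (Finset ι) ℂ) (ψ : Fock ι) :
    expect (∑ k ∈ s, f k) ψ = ∑ k ∈ s, expect (f k) ψ := by
  unfold Literature.MathematicalPhysics.QuantumLattice.expect
  rw [Matrix.sum_mulVec, dotProduct_sum]

/-- `⟨Mᴴφ, A Mᴴφ⟩ = ⟨φ, (M A Mᴴ) φ⟩`. [folklore] -/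
private theorem expect_conjTranspose_mulVec₄ {ι : Type*} [LinearOrder ι] [Fintype ι]
    (A M : Matrix (Finset ι) (Finset ι) ℂ) (φ : Fock ι) :
    expect A (Mᴴ *ᵥ φ) = expect (M * A * Mᴴ) φ := by
  unfold Literature.MathematicalPhysics.QuantumLattice.expect
  rw [star_mulVec, conjTranspose_conjTranspose, ← dotProduct_mulVec, mulVec_mulVec, mulVec_mulVec]

/-- `relabel π [K, Z] = [K, relabel π Z]` when `π` fixes `K`. [folklore] -/
private theorem relabel_commutator_of_fixed' {ι : Type*} [LinearOrder ι] [Fintype ι] (π : Equiv.Perm ι)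
    {K : Matrix (Finset ι) (Finset ι) ℂ} (hK : relabel π K = K) (Z : Matrix (Finset ι) (Finset ι) ℂ) :
    relabel π (K * Z - Z * K) = K * relabel π Z - relabel π Z * K := by
  rw [relabel_sub, relabel_mul, relabel_mul, hK]

/-- **The flip-twisted-orbit state of a commutator with an invariant torus operator.** For a finite `S ⊆ D₄`, a
window `Λ'` fitting into the torus, `X ∈ 𝔄_{Λ'}`, a torus operator `K` invariant under the point group and the
translations and commuting with `N̂` and with the spin flip `F` (`K = H_L − μ'N̂`), and any torus vector `ζ`:
`ω̄^{twf}_ζ(K Γ_L X − Γ_L X K) = (4|S|)⁻¹ Σ_{γ∈S} Σ_{f} Σ_{m} L⁻² ⟨ζ, (K W_{γ,f,m} − W_{γ,f,m} K) ζ⟩`,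
`W_{γ,f,m} = Σ_v T_v Γ_{L,γΛ'}(Γ(d4Emb γ 0 Λ') F^f(𝒢_k X 𝒢_kᴴ))`, `k = j(γ)+f+2m`
(`fockGauge_conj_fermionEmbed`, `fermionEmbed_toTorusEmb_spinSwapIter`).
[cite: BratteliRobinsonII1997, §6.2.4] [cite: Han2020Bootstrap, §3] -/
theorem orbitState_twistedFlipSpaceGroupUnitary_commutator_fermionEmbed_of_invariant (S : Finset (DihedralGroup 4))
    (K : Matrix (Finset (Orb (FermionTorus 2 L))) (Finset (Orb (FermionTorus 2 L))) ℂ)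
    (hKD : ∀ γ : DihedralGroup 4, relabel (Orb.d4Perm (L := L) γ) K = K)
    (hKT : ∀ v : TorusSite 2 L, relabel (Orb.translate v) K = K)
    (hKN : Commute totalNumberOp K) (hKF : Commute fockSpinFlip K)
    {Λ' : Finset (Site 2)} (hInj' : Set.InjOn (Torus.proj (d := 2) L) ↑Λ') (X : FermionOp Λ')
    (ζ : Fock (Orb (FermionTorus 2 L))) :
    orbitState (twistedFlipSpaceGroupUnitary S) ζ
        (K * fermionEmbed (PolySite.toTorusEmb L hInj') X - fermionEmbed (PolySite.toTorusEmb L hInj') X * K) =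
      ((S.card : ℂ) * 2 * 2)⁻¹ * ∑ γ ∈ S, ∑ f : Fin 2, ∑ m : Fin 2, ((Fintype.card (TorusSite 2 L) : ℂ))⁻¹ *
        expect (K *
            (∑ v : TorusSite 2 L, relabel (Orb.translate v)
              (fermionEmbed (PolySite.toTorusEmb L ((injOn_proj_d4ShiftSet_iff L γ 0 Λ').2 hInj'))
                (fermionEmbed (PolySite.d4Emb γ 0 Λ') (spinSwapIter (f : ℕ)
                  (fockGauge (twistFlipExp γ f m) * X * (fockGauge (twistFlipExp γ f m))ᴴ))))) -
          (∑ v : TorusSite 2 L, relabel (Orb.translate v)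
              (fermionEmbed (PolySite.toTorusEmb L ((injOn_proj_d4ShiftSet_iff L γ 0 Λ').2 hInj'))
                (fermionEmbed (PolySite.d4Emb γ 0 Λ') (spinSwapIter (f : ℕ)
                  (fockGauge (twistFlipExp γ f m) * X * (fockGauge (twistFlipExp γ f m))ᴴ))))) * K) ζ := by
  set Y := fermionEmbed (PolySite.toTorusEmb L hInj') X with hY
  have hInjγ : ∀ γ : DihedralGroup 4, Set.InjOn (Torus.proj (d := 2) L) ↑(d4ShiftSet γ 0 Λ') := fun γ =>
    (injOn_proj_d4ShiftSet_iff L γ 0 Λ').2 hInj'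
  set Yc : DihedralGroup 4 → Fin 2 → Fin 2 →
      Matrix (Finset (Orb (FermionTorus 2 L))) (Finset (Orb (FermionTorus 2 L))) ℂ :=
    fun γ f m => fermionEmbed (PolySite.toTorusEmb L (hInjγ γ))
      (fermionEmbed (PolySite.d4Emb γ 0 Λ') (spinSwapIter (f : ℕ)
        (fockGauge (twistFlipExp γ f m) * X * (fockGauge (twistFlipExp γ f m))ᴴ))) with hYc
  -- gauge and flip conjugation of `[K, ·]`
  have hG : ∀ k : ℕ, fockGauge k * (K * Y - Y * K) * (fockGauge k)ᴴ =
      K * (fockGauge k * Y * (fockGauge k)ᴴ) - (fockGauge k * Y * (fockGauge k)ᴴ) * K := by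
    intro k
    have h1 : fockGauge k * K = K * fockGauge k := (Commute.fockGauge_of_totalNumberOp hKN k).eq
    have h2 : K * (fockGauge k)ᴴ = (fockGauge k)ᴴ * K := by
      rw [conjTranspose_fockGauge]
      exact ((Commute.fockGauge_of_totalNumberOp hKN _).eq).symm
    rw [Matrix.mul_sub, Matrix.sub_mul]
    simp only [Matrix.mul_assoc]
    rw [← h2, ← Matrix.mul_assoc (fockGauge k) K (Y * (fockGauge k)ᴴ), h1, Matrix.mul_assoc]
  have hF : ∀ (f : ℕ) (Z : Matrix (Finset (Orb (FermionTorus 2 L))) (Finset (Orb (FermionTorus 2 L))) ℂ),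
      fockSpinFlip ^ f * (K * Z - Z * K) * (fockSpinFlip ^ f)ᴴ =
        K * (fockSpinFlip ^ f * Z * (fockSpinFlip ^ f)ᴴ) - (fockSpinFlip ^ f * Z * (fockSpinFlip ^ f)ᴴ) * K := by
    intro f Z
    have h1 : fockSpinFlip ^ f * K = K * fockSpinFlip ^ f := (hKF.pow_left f).eq
    have h2 : K * (fockSpinFlip ^ f)ᴴ = (fockSpinFlip ^ f)ᴴ * K := by
      rw [Matrix.conjTranspose_pow, conjTranspose_fockSpinFlip]
      exact ((hKF.pow_left f).eq).symm
    rw [Matrix.mul_sub, Matrix.sub_mul]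
    simp only [Matrix.mul_assoc]
    rw [← h2, ← Matrix.mul_assoc (fockSpinFlip ^ f) K (Z * (fockSpinFlip ^ f)ᴴ), h1, Matrix.mul_assoc]
  have hproj0 : Torus.proj L (0 : Site 2) = 0 := by
    funext i
    simp [Torus.proj]
  have hrot : ∀ (γ : DihedralGroup 4) (f m : Fin 2),
      relabel (Orb.d4Perm (L := L) γ) (fockSpinFlip ^ (f : ℕ) *
        (fockGauge (twistFlipExp γ f m) * Y * (fockGauge (twistFlipExp γ f m))ᴴ) * (fockSpinFlip ^ (f : ℕ))ᴴ) =
        Yc γ f m := by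
    intro γ f m
    rw [hY, fockGauge_conj_fermionEmbed, ← fermionEmbed_toTorusEmb_spinSwapIter]
    simp only [hYc]
    rw [fermionEmbed_toTorusEmb_d4Emb γ 0 hInj' (hInjγ γ), hproj0, Orb.translate_zero, Equiv.Perm.one_def,
      relabel_refl]
  have hterm : ∀ (v : TorusSite 2 L) (γ : ↥S) (f m : Fin 2),
      Literature.MathematicalPhysics.QuantumManyBody.StateRelaxation.vectorState
          ((twistedFlipSpaceGroupUnitary S (((v, γ), f), m))ᴴ *ᵥ ζ) (K * Y - Y * K) =
        expect (K * relabel (Orb.translate v) (Yc γ f m) - relabel (Orb.translate v) (Yc γ f m) * K) ζ := by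
    rintro v ⟨γ, hγ⟩ f m
    rw [Literature.MathematicalPhysics.QuantumManyBody.StateRelaxation.vectorState_apply,
      show star ((twistedFlipSpaceGroupUnitary S (((v, ⟨γ, hγ⟩), f), m))ᴴ *ᵥ ζ) ⬝ᵥ
          (K * Y - Y * K) *ᵥ ((twistedFlipSpaceGroupUnitary S (((v, ⟨γ, hγ⟩), f), m))ᴴ *ᵥ ζ) =
        expect (K * Y - Y * K) ((twistedFlipSpaceGroupUnitary S (((v, ⟨γ, hγ⟩), f), m))ᴴ *ᵥ ζ) from rfl,
      expect_conjTranspose_mulVec₄, twistedFlipSpaceGroupUnitary_apply]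
    simp only
    rw [conjTranspose_mul, conjTranspose_mul,
      show spaceGroupUnitary S (v, ⟨γ, hγ⟩) * fockSpinFlip ^ (f : ℕ) * fockGauge (twistFlipExp γ f m) *
          (K * Y - Y * K) *
          ((fockGauge (twistFlipExp γ f m))ᴴ * ((fockSpinFlip ^ (f : ℕ))ᴴ * (spaceGroupUnitary S (v, ⟨γ, hγ⟩))ᴴ)) =
        spaceGroupUnitary S (v, ⟨γ, hγ⟩) * (fockSpinFlip ^ (f : ℕ) *
          (fockGauge (twistFlipExp γ f m) * (K * Y - Y * K) * (fockGauge (twistFlipExp γ f m))ᴴ) *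
          (fockSpinFlip ^ (f : ℕ))ᴴ) * (spaceGroupUnitary S (v, ⟨γ, hγ⟩))ᴴ by simp only [Matrix.mul_assoc],
      hG, hF,
      show spaceGroupUnitary S (v, ⟨γ, hγ⟩) *
          (K * (fockSpinFlip ^ (f : ℕ) * (fockGauge (twistFlipExp γ f m) * Y * (fockGauge (twistFlipExp γ f m))ᴴ) *
              (fockSpinFlip ^ (f : ℕ))ᴴ) -
            fockSpinFlip ^ (f : ℕ) * (fockGauge (twistFlipExp γ f m) * Y * (fockGauge (twistFlipExp γ f m))ᴴ) *
              (fockSpinFlip ^ (f : ℕ))ᴴ * K) *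
          (spaceGroupUnitary S (v, ⟨γ, hγ⟩))ᴴ =
        (fockTranslate v).val * (fockD4 (L := L) γ).val *
          (K * (fockSpinFlip ^ (f : ℕ) * (fockGauge (twistFlipExp γ f m) * Y * (fockGauge (twistFlipExp γ f m))ᴴ) *
              (fockSpinFlip ^ (f : ℕ))ᴴ) -
            fockSpinFlip ^ (f : ℕ) * (fockGauge (twistFlipExp γ f m) * Y * (fockGauge (twistFlipExp γ f m))ᴴ) *
              (fockSpinFlip ^ (f : ℕ))ᴴ * K) *
          ((fockTranslate v).val * (fockD4 (L := L) γ).val)ᴴ from rfl,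
      d4Affine_conj, relabel_commutator_of_fixed' _ (hKD γ), hrot γ f m, relabel_commutator_of_fixed' _ (hKT v)]
  -- sum over the family
  rw [orbitState_apply, Fintype.sum_prod_type, Fintype.sum_prod_type, Fintype.sum_prod_type]
  simp_rw [hterm]
  have hinner : ∀ (γ : ↥S) (f m : Fin 2),
      ∑ v : TorusSite 2 L,
          expect (K * relabel (Orb.translate v) (Yc γ f m) - relabel (Orb.translate v) (Yc γ f m) * K) ζ =
        expect (K * (∑ v : TorusSite 2 L, relabel (Orb.translate v) (Yc γ f m)) -
          (∑ v : TorusSite 2 L, relabel (Orb.translate v) (Yc γ f m)) * K) ζ := by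
    intro γ f m
    rw [Finset.mul_sum, Finset.sum_mul, ← Finset.sum_sub_distrib, expect_finset_sum₄]
  rw [Finset.sum_comm (s := (Finset.univ : Finset (TorusSite 2 L))) (t := (Finset.univ : Finset ↥S))]
  have hswap : ∀ γ : ↥S, ∑ v : TorusSite 2 L, ∑ f : Fin 2, ∑ m : Fin 2,
      expect (K * relabel (Orb.translate v) (Yc γ f m) - relabel (Orb.translate v) (Yc γ f m) * K) ζ =
        ∑ f : Fin 2, ∑ m : Fin 2, expect (K * (∑ v : TorusSite 2 L, relabel (Orb.translate v) (Yc γ f m)) -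
          (∑ v : TorusSite 2 L, relabel (Orb.translate v) (Yc γ f m)) * K) ζ := by
    intro γ
    rw [Finset.sum_comm (s := (Finset.univ : Finset (TorusSite 2 L))) (t := (Finset.univ : Finset (Fin 2)))]
    refine Finset.sum_congr rfl fun f _ => ?_
    rw [Finset.sum_comm (s := (Finset.univ : Finset (TorusSite 2 L))) (t := (Finset.univ : Finset (Fin 2)))]
    exact Finset.sum_congr rfl fun m _ => hinner γ f m
  rw [Finset.sum_congr rfl fun γ _ => hswap γ,
    Finset.sum_coe_sort S (fun γ : DihedralGroup 4 => ∑ f : Fin 2, ∑ m : Fin 2,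
      expect (K * (∑ v : TorusSite 2 L, relabel (Orb.translate v) (Yc γ f m)) -
        (∑ v : TorusSite 2 L, relabel (Orb.translate v) (Yc γ f m)) * K) ζ)]
  simp_rw [← Finset.mul_sum]
  rw [← mul_assoc, Fintype.card_prod, Fintype.card_prod, Fintype.card_prod, Fintype.card_coe, Fintype.card_fin]
  have hS : (((Fintype.card (TorusSite 2 L) * S.card * 2 * 2 : ℕ)) : ℂ)⁻¹ =
      ((S.card : ℂ) * 2 * 2)⁻¹ * ((Fintype.card (TorusSite 2 L) : ℂ))⁻¹ := by
    push_cast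
    rw [mul_inv, mul_inv, mul_inv, mul_inv, mul_inv]; ring
  rw [hS]

/-- **The flip-twisted space-group sum of the rotated translation sums is ONE translation sum** of the symmetrised
spin-exchanged gauge-conjugated word: with `Ω ⊇ γΛ'` for all `γ ∈ S`,
`Σ_{γ∈S} Σ_f Σ_m W_{γ,f,m} = Σ_v T_v Γ_{L,Ω}(Σ_{γ∈S} Σ_f Σ_m Γ(incl)(Γ(d4Emb γ 0 Λ') F^f(𝒢_k X 𝒢_kᴴ)))`.
[cite: BratteliRobinsonII1997, §6.2.4] -/
theorem sum_translate_twistedFlipSpaceGroupAverage_eq (S : Finset (DihedralGroup 4)) {Λ' Ω : Finset (Site 2)}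
    (hInj' : Set.InjOn (Torus.proj (d := 2) L) ↑Λ') (hΩ : Set.InjOn (Torus.proj (d := 2) L) ↑Ω)
    (hsub : ∀ γ ∈ S, d4ShiftSet γ 0 Λ' ⊆ Ω) (X : FermionOp Λ') :
    ∑ γ ∈ S, ∑ f : Fin 2, ∑ m : Fin 2, (∑ v : TorusSite 2 L, relabel (Orb.translate v)
        (fermionEmbed (PolySite.toTorusEmb L ((injOn_proj_d4ShiftSet_iff L γ 0 Λ').2 hInj'))
          (fermionEmbed (PolySite.d4Emb γ 0 Λ') (spinSwapIter (f : ℕ)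
            (fockGauge (twistFlipExp γ f m) * X * (fockGauge (twistFlipExp γ f m))ᴴ))))) =
      ∑ v : TorusSite 2 L, relabel (Orb.translate v) (fermionEmbed (PolySite.toTorusEmb L hΩ)
        (∑ γ ∈ S.attach, ∑ f : Fin 2, ∑ m : Fin 2, fermionEmbed (PolySite.incl (hsub γ.1 γ.2))
          (fermionEmbed (PolySite.d4Emb γ.1 0 Λ') (spinSwapIter (f : ℕ)
            (fockGauge (twistFlipExp γ.1 f m) * X * (fockGauge (twistFlipExp γ.1 f m))ᴴ))))) := by
  have hR : ∀ v : TorusSite 2 L, relabel (Orb.translate v) (fermionEmbed (PolySite.toTorusEmb L hΩ)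
      (∑ γ ∈ S.attach, ∑ f : Fin 2, ∑ m : Fin 2, fermionEmbed (PolySite.incl (hsub γ.1 γ.2))
        (fermionEmbed (PolySite.d4Emb γ.1 0 Λ') (spinSwapIter (f : ℕ)
          (fockGauge (twistFlipExp γ.1 f m) * X * (fockGauge (twistFlipExp γ.1 f m))ᴴ))))) =
      ∑ γ ∈ S, ∑ f : Fin 2, ∑ m : Fin 2, relabel (Orb.translate v)
        (fermionEmbed (PolySite.toTorusEmb L ((injOn_proj_d4ShiftSet_iff L γ 0 Λ').2 hInj'))
          (fermionEmbed (PolySite.d4Emb γ 0 Λ') (spinSwapIter (f : ℕ)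
            (fockGauge (twistFlipExp γ f m) * X * (fockGauge (twistFlipExp γ f m))ᴴ)))) := by
    intro v
    rw [fermionEmbed_sum, relabel_sum, ← Finset.sum_attach S]
    refine Finset.sum_congr rfl fun γ _ => ?_
    rw [fermionEmbed_sum, relabel_sum]
    refine Finset.sum_congr rfl fun f _ => ?_
    rw [fermionEmbed_sum, relabel_sum]
    refine Finset.sum_congr rfl fun m _ => ?_
    rw [fermionEmbed_toTorusEmb_incl (hsub γ.1 γ.2) hΩ]
  simp_rw [hR]
  rw [Finset.sum_comm (s := (Finset.univ : Finset (TorusSite 2 L))) (t := S)]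
  refine Finset.sum_congr rfl fun γ _ => ?_
  rw [Finset.sum_comm (s := (Finset.univ : Finset (TorusSite 2 L))) (t := (Finset.univ : Finset (Fin 2)))]
  refine Finset.sum_congr rfl fun f _ => ?_
  rw [Finset.sum_comm (s := (Finset.univ : Finset (Fin 2))) (t := (Finset.univ : Finset (TorusSite 2 L)))]

end TwistedFlipReading

end Summit.Ventures.CertifiedManyBodySolver.Observables

end
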